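import Summits.HodgeConjecture.HodgeConjecture.Theorems.Ring2MotivConiveauThreeOne
import Literature.AlgebraicGeometry.HodgeTheory.WeilClassesIsogenyDescent
import Literature.AlgebraicGeometry.HodgeTheory.WeilClassesProductsOfFactors
import HarnessLib

/-!
# Ring 2 · motiv (generation 66) — the degenerate-CM cusp cores `B × E₀²` of habitat B: their Weil classes are
algebraic from Schoen 1998 ALONE (`K = ℚ(√-3)`), resp. Koike 2004 alone (`K = ℚ(i)`); `HC_CM` is NOT needed

HONEST FRAMING (cell `pub-hodge-ring2`, seat `motiv`, verbatim): research route conditional on HC_CM; not a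
corollary; Q11.4-sentence-2 already refuted in dim ≥ 3. `HC_CM` (:= `Theses.RankFourFaces.CMAbelianHodge`) occurs
NOWHERE in this file: every theorem below is either unconditional or takes ONE printed sixfold theorem as a
NAMED-FACT hypothesis (`(hS : Schoen1998_…)` refereed, `(hK : Koike2004_…)` refereed, `(hM : Markman2025_…)`
UNREFEREED), exactly as the rest of the layer does. No named fact is introduced or discharged; nothing derived by the
cell is entered as a fact.

THE QUESTION (habitat2 gen 39, `DEGCM-B`, answer to LEAD L45.4 (d); exact CM-torus computation): at each of the 144
degenerate-CM cusp classes (896 cusps, 24 braid orbits) of the family `(-3,24), k = 4` the cusp abelian variety `X₀`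
(`dim X₀ = h ∈ {6, 8}`, `K = ℚ(√-3)` acting with `K`-type `(h/2, h/2)`) is `K`-isogenous to a product of CM pieces, and
the Weil line `W_K|X₀` is `(ν divisor classes) ∧ ω` with `ω` a Hodge class of degree `6` on the SAME core
`A'' = E_ω² × B₄₈` in every class — `B₄₈` the simple CM fourfold factor of `J(y⁴⁸ = x(1-x)¹⁶)` carrying `K`-type
`(3,1)` or `(1,3)`, `E_ω²` carrying `K`-type `(0,2)` resp. `(2,0)` — lying OUTSIDE the divisor algebra of the CM
variety `X₀` (`h = 6`: `X₀ ~ A''`, 48 classes, `ν = 0`; `h = 8`: `X₀ ~ S × A''` with `S` a `K`-surface of type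
`(1,1)` — `E_ω(1,0) × E_ω(0,1)` (32 classes) or `E_i²` (64 classes) —, `ν = 1`). habitat2's verdict: "EXCEPTIONAL ×144;
algebraic ⟸ HC_CM[X₀]; nothing in this cell decides it".

THE READING PROVED HERE (kernel, 0 sorry; the new content is COMPOSITION — the load-bearing inputs are tree theorems
cited by name and COUNTED ONCE: the AbelianAll seat's `isSplitWeilType_odd_prod_curve` (every Weil-type `A × E` with
`dim A` odd is SPLIT — weighted Segre polarisation, van Geemen 5.2 (4), Landherr) through atlas-2's re-association
`Ring2.Atlas.weilAlgebraicFor_three_fourfold_prod_curve_sq_of_{schoen, koike, markmanSixfolds}`; the Literature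
isogeny-descent and product lemmas `mem_algebraicClasses_of_isogeny_of_mem_weilClassesOf`,
`mem_algebraicClasses_of_isogeny_prod`, `weilClassesOf_le_algebraicClasses_surface`). A `K`-type `(0,2)` (or `(2,0)`)
structure on `E_ω²` is SCALAR (`K` acts on `H^{1,0}(E_ω²)` by one embedding, hence through `K₀ = End⁰(E_ω) ≅ K`
diagonally: `ψ₀ × ψ₀` with `ψ₀ = ∓√-3 = ∓(2ω+1) ∈ End(E_ω)`), so the core is EXACTLY the tree's `Y × (E₀ × E₀)` with
`Y := B₄₈` (`dim 4`, `ψ² = -3`), `E₀ := E_ω` a curve, `φ × (ψ₀ × ψ₀)` of Weil type `(3,3)`: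

* §1 `weilClassesOf_core_le_algebraicClasses_of_{schoen1998, koike, markman}`: the complexified Weil plane of the core
  `(Y × (E₀ × E₀), ψ × (ψ₀ × ψ₀))` of Weil type `(3,d)`, `Y` ANY abelian fourfold with `ψ² = -d`, `E₀` ANY curve with
  `ψ₀² = -d`, consists of algebraic classes — granted ONLY Schoen 1998 (`d = 3`), resp. Koike 2004 (`d = 1`), resp.
  Markman's F2 (any `d`, UNREFEREED). No hyperbolicity / discriminant hypothesis: the pair is split.
* §2 (`h = 6`, the 48 classes) `weilClass_algebraic_of_isogeny_core_of_{schoen1998, koike, markman}`: for a sixfold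
  `(X₀, θ)` with a `K`-equivariant isogeny pair to the core (`f : X₀ ⟶ core` flat, `g : core ⟶ X₀`,
  `g ≫ θ = (ψ × (ψ₀ × ψ₀)) ≫ g`, `f ≫ g = m`, `m ≥ 1`), every rational `(3,3)` class of the Weil plane of `(X₀, θ)` is
  algebraic; submodule form `weilClassesOf_le_algebraicClasses_of_isogeny_core_of_schoen1998`.
* §3 (`h = 8`, the 96 classes) `weilClass_algebraic_of_isogeny_surface_prod_core_of_{schoen1998, koike, markman}`: for
  an eightfold `(X₀, θ)` with a `K`-equivariant isogeny pair to `S × core`, `(S, σ)` ANY Weil-type `(1,d)` surface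
  (both `S = E_ω(1,0) × E_ω(0,1)` and `S = E_i²` with `ℚ(√-3) ⊂ M₂(ℚ) ⊂ End⁰(E_i²)` are such), every rational `(4,4)`
  class of the Weil plane of `(X₀, θ)` is algebraic (the surface factor is peeled by Lefschetz (1,1)).
* §0 on-path: each conclusion is an instance of the summit statement (`…_onPath`).

PRINT STATUS (numbers, not adjectives). For the 144 classes of `DEGCM-B` the inputs are Schoen 1998 §§10–13 (with
Schoen 1988 Thm. 3.0; refereed) + van Geemen 1994 5.2/6.12 + Landherr 1936: decided IN REFEREED PRINT by composition;
`HC_CM[X₀]` is not invoked; no discriminant of `A''` is computed (none is needed: a `(3,3)` pair with a curve factor is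
split). What is NOT claimed: the census WORDS for these classes (LEAD's ruling; this file is the kernel reading offered
to it), anything about the non-cusp members of the 24 orbits, the full Hodge ring of `X₀` (only its `K`-Weil plane in
the middle degree), and the per-class `K`-isogeny data `(f, g, m)` (habitat2's tables `out/degcm_B.json`, entering
here as HYPOTHESES). PROVENANCE: each statement is the composition of the cited printed steps and of the named tree
theorems, not itself a numbered result of the sources.

## References
* [Schoen1998HodgeWeilAddendum] C. Schoen, Compositio Math. 114 (1998), Theorem (p. 329), §§10–13.
  [Schoen1988HodgeWeil] Compositio Math. 65 (1988), Thm. 3.0.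
* [Koike2004WeilHodge] K. Koike, Canad. Math. Bull. 47 (2004), Thm. 2.1 and Cor. 2.1.
* [Markman2025SecantWeil] E. Markman, arXiv:2502.03415, Thm. 1.5.1 (UNREFEREED). [Markman2025SurveySecant] §11.5.
* [vanGeemen1994HodgeAV] B. van Geemen, LNM 1594 (1994), 3.6–3.7, 4.9–4.10, Lemma 5.2 (1)–(4), 5.4, Thm. 6.12.
* [MoonenZarhin1999LowDim] B. Moonen, Yu. Zarhin, Math. Ann. 315 (1999), Thm. 0.1 (the surface factor).
* [Landherr1936HermitianForms]. [Shioda1979HodgeFermat] T. Shioda, Math. Ann. 245 (1979) (the Fermat pieces `B₄₈`, `E_ω`).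
-/

set_option linter.dupNamespace false

noncomputable section

open CategoryTheory

namespace Summit.HodgeConjecture.HodgeConjecture.Ring2.Motiv

open Literature.AlgebraicGeometry Literature.AlgebraicGeometry.Motives
open Literature.AlgebraicGeometry.HodgeTheory
open Literature.AlgebraicTopology.SingularHomology
open Summit.HodgeConjecture.HodgeConjecture.Ring2.Atlas
open Summit.HodgeConjecture.HodgeConjecture.Cruxes.HodgeAbelianVarieties.EStepSecantInduction (WeilAlgebraicFor)

/-- File-local notation: the diagonal structure `ψ × (ψ₀ × ψ₀)` on the core `Y × (E₀ × E₀)`. -/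
local notation "𝚿[" ψ ", " ψ₀ "]" =>
  AbelianVariety.prodLift (AbelianVariety.fst _ _ ≫ ψ)
    (AbelianVariety.snd _ _ ≫ AbelianVariety.prodLift (AbelianVariety.fst _ _ ≫ ψ₀) (AbelianVariety.snd _ _ ≫ ψ₀))

variable {Y E₀ : AbelianVariety ℂ} {ψ : Y ⟶ Y} {ψ₀ : E₀ ⟶ E₀} {d : ℕ}

/-! ## §1 The core `(Y × (E₀ × E₀), ψ × (ψ₀ × ψ₀))`: its complexified Weil plane consists of algebraic classes -/

section Core

/-- **The core, granted the pointwise statement `WeilAlgebraicFor 3 d`** (fact-free bridge): on a Weil-type `(3,d)`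
core the pointwise algebraicity of rational `(3,3)` Weil classes gives the submodule statement
`weilClassesOf ⊆ algebraicClasses` (van Geemen 4.9–4.10: the Weil plane is spanned by rational classes).
[cite: vanGeemen1994HodgeAV, 4.9–4.10 and Thm. 6.12] -/
theorem weilClassesOf_core_le_algebraicClasses_of_weilAlgebraicFor
    (hW : IsWeilType (Y.prod (E₀.prod E₀)) 𝚿[ψ, ψ₀] 3 d)
    (h : WeilAlgebraicFor 3 d (Y.prod (E₀.prod E₀)) 𝚿[ψ, ψ₀]) :
    weilClassesOf (Y.prod (E₀.prod E₀)) 𝚿[ψ, ψ₀] 3 d ≤ algebraicClasses (Y.prod (E₀.prod E₀)).X 3 :=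
  weilClassesOf_le_algebraicClasses_of_weilAlgebraicFor hW h

/-- **`K = ℚ(√-3)`: the core, granted Schoen 1998 ALONE** (refereed). `Y` any abelian fourfold with `ψ² = -3`, `E₀`
any curve with `ψ₀² = -3`, the core of Weil type `(3,3)` (e.g. `Y = B₄₈` of `K`-type `(3,1)` and `E₀ = E_ω` with the
scalar structure of type `(0,1)`, habitat B `DEGCM-B`): `weilClassesOf ⊆ algebraicClasses` in degree `6`. The pair is
split (`isSplitWeilType_odd_prod_curve`), so no discriminant enters.
[cite: Schoen1998HodgeWeilAddendum, Theorem (p. 329) and §§10–13] [cite: vanGeemen1994HodgeAV, Lemma 5.2 (4), 5.4, Thm. 6.12] -/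
theorem weilClassesOf_core_le_algebraicClasses_of_schoen1998
    (hS : Schoen1998_weilClasses_algebraic_hyperbolicSixfold_three) (hY : Y.dim = 4) (hE : E₀.dim = 1)
    (hψ : ψ ≫ ψ = -((3 : ℕ) • 𝟙 Y)) (hψ₀ : ψ₀ ≫ ψ₀ = -((3 : ℕ) • 𝟙 E₀))
    (hW : IsWeilType (Y.prod (E₀.prod E₀)) 𝚿[ψ, ψ₀] 3 3) :
    weilClassesOf (Y.prod (E₀.prod E₀)) 𝚿[ψ, ψ₀] 3 3 ≤ algebraicClasses (Y.prod (E₀.prod E₀)).X 3 :=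
  weilClassesOf_core_le_algebraicClasses_of_weilAlgebraicFor hW
    (weilAlgebraicFor_three_fourfold_prod_curve_sq_of_schoen hS hY hE hψ hψ₀ hW)

/-- **`K = ℚ(i)`: the core, granted Koike 2004 ALONE** (refereed): same statement with `d = 1`.
[cite: Koike2004WeilHodge, Thm. 2.1 and Cor. 2.1] [cite: vanGeemen1994HodgeAV, Lemma 5.2 (4), 5.4, Thm. 6.12] -/
theorem weilClassesOf_core_le_algebraicClasses_of_koike
    (hK : Koike2004_weilClasses_algebraic_hyperbolicSixfold_one) (hY : Y.dim = 4) (hE : E₀.dim = 1)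
    (hψ : ψ ≫ ψ = -((1 : ℕ) • 𝟙 Y)) (hψ₀ : ψ₀ ≫ ψ₀ = -((1 : ℕ) • 𝟙 E₀))
    (hW : IsWeilType (Y.prod (E₀.prod E₀)) 𝚿[ψ, ψ₀] 3 1) :
    weilClassesOf (Y.prod (E₀.prod E₀)) 𝚿[ψ, ψ₀] 3 1 ≤ algebraicClasses (Y.prod (E₀.prod E₀)).X 3 :=
  weilClassesOf_core_le_algebraicClasses_of_weilAlgebraicFor hW
    (weilAlgebraicFor_three_fourfold_prod_curve_sq_of_koike hK hY hE hψ hψ₀ hW)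

/-- **Any `K = ℚ(√-d)`: the core, granted Markman's F2** (UNREFEREED, arXiv:2502.03415 Thm. 1.5.1).
[cite: Markman2025SecantWeil, Thm. 1.5.1] [cite: vanGeemen1994HodgeAV, Lemma 5.2 (4), 5.4, Thm. 6.12] -/
theorem weilClassesOf_core_le_algebraicClasses_of_markman
    (hM : Markman2025_weilClasses_algebraic_hyperbolicSixfold) (hY : Y.dim = 4) (hE : E₀.dim = 1)
    (hd : 0 < d) (hψ : ψ ≫ ψ = -(d • 𝟙 Y)) (hψ₀ : ψ₀ ≫ ψ₀ = -(d • 𝟙 E₀))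
    (hW : IsWeilType (Y.prod (E₀.prod E₀)) 𝚿[ψ, ψ₀] 3 d) :
    weilClassesOf (Y.prod (E₀.prod E₀)) 𝚿[ψ, ψ₀] 3 d ≤ algebraicClasses (Y.prod (E₀.prod E₀)).X 3 :=
  weilClassesOf_core_le_algebraicClasses_of_weilAlgebraicFor hW
    (weilAlgebraicFor_three_fourfold_prod_curve_sq_of_markmanSixfolds hM hY hE hd hψ hψ₀ hW)

end Core

/-! ## §2 `h = 6`: sixfolds `K`-isogenous to the core (the 48 classes of `DEGCM-B` with `X₀ ~ E_ω² × B₄₈`) -/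

section Sixfold

variable {X₀ : AbelianVariety ℂ} {θ : X₀ ⟶ X₀}

/-- **Sixfolds `K`-isogenous to the core, granted `WeilAlgebraicFor 3 d` on the core** (fact-free): isogeny pair
`f : X₀ ⟶ core` (flat), `g : core ⟶ X₀` with `g ≫ θ = (ψ × (ψ₀ × ψ₀)) ≫ g` and `f ≫ g = m`, `m ≥ 1`; then every
rational `(3,3)` class of the Weil plane of `(X₀, θ)` is algebraic (pull back by `g`, push forward by `f`).
[cite: vanGeemen1994HodgeAV, 3.6–3.7 and 4.9] -/
theorem weilClass_algebraic_of_isogeny_core_of_weilAlgebraicFor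
    (hW : IsWeilType (Y.prod (E₀.prod E₀)) 𝚿[ψ, ψ₀] 3 d)
    (h : WeilAlgebraicFor 3 d (Y.prod (E₀.prod E₀)) 𝚿[ψ, ψ₀])
    (hX₀ : X₀.dim = 2 * 3) (MB : HodgeModel (2 * 3) (Y.prod (E₀.prod E₀)).X)
    (f : X₀ ⟶ Y.prod (E₀.prod E₀)) (g : Y.prod (E₀.prod E₀) ⟶ X₀) [AlgebraicGeometry.Flat f.hom.hom.hom.left]
    (hg : g ≫ θ = 𝚿[ψ, ψ₀] ≫ g) {m : ℕ} (hm : 0 < m) (hfg : f ≫ g = m • 𝟙 X₀)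
    {c : complexBetti X₀.X (2 * 3)} (hc : IsRationalClass c) (hcH : IsOfHodgeType (2 * 3) X₀.X (2 * 3) 3 3 c)
    (hcW : c ∈ weilClassesOf X₀ θ 3 d) : c ∈ algebraicClasses X₀.X 3 :=
  mem_algebraicClasses_of_isogeny_of_mem_weilClassesOf (Motives.isSmoothProjective_of_dim_eq' hX₀)
    hW.isSmoothProjective MB f g hg hm hfg (fun c hcQ hcH hw ↦ h c hw hcQ hcH) hc hcH hcW

/-- **`K = ℚ(√-3)`, `h = 6`: sixfolds `K`-isogenous to the core `Y × E₀²` have algebraic rational `(3,3)` Weil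
classes, granted Schoen 1998 ALONE** (refereed) — the 48 classes of `DEGCM-B` with `X₀ ~ E_ω² × B₄₈`
(`Y := B₄₈`, `E₀ := E_ω`). [cite: Schoen1998HodgeWeilAddendum, Theorem (p. 329) and §§10–13]
[cite: vanGeemen1994HodgeAV, 3.6–3.7, 4.9, Lemma 5.2 (4), Thm. 6.12] -/
theorem weilClass_algebraic_of_isogeny_core_of_schoen1998
    (hS : Schoen1998_weilClasses_algebraic_hyperbolicSixfold_three) (hY : Y.dim = 4) (hE : E₀.dim = 1)
    (hψ : ψ ≫ ψ = -((3 : ℕ) • 𝟙 Y)) (hψ₀ : ψ₀ ≫ ψ₀ = -((3 : ℕ) • 𝟙 E₀))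
    (hW : IsWeilType (Y.prod (E₀.prod E₀)) 𝚿[ψ, ψ₀] 3 3)
    (hX₀ : X₀.dim = 2 * 3) (MB : HodgeModel (2 * 3) (Y.prod (E₀.prod E₀)).X)
    (f : X₀ ⟶ Y.prod (E₀.prod E₀)) (g : Y.prod (E₀.prod E₀) ⟶ X₀) [AlgebraicGeometry.Flat f.hom.hom.hom.left]
    (hg : g ≫ θ = 𝚿[ψ, ψ₀] ≫ g) {m : ℕ} (hm : 0 < m) (hfg : f ≫ g = m • 𝟙 X₀)
    {c : complexBetti X₀.X (2 * 3)} (hc : IsRationalClass c) (hcH : IsOfHodgeType (2 * 3) X₀.X (2 * 3) 3 3 c)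
    (hcW : c ∈ weilClassesOf X₀ θ 3 3) : c ∈ algebraicClasses X₀.X 3 :=
  weilClass_algebraic_of_isogeny_core_of_weilAlgebraicFor hW
    (weilAlgebraicFor_three_fourfold_prod_curve_sq_of_schoen hS hY hE hψ hψ₀ hW) hX₀ MB f g hg hm hfg hc hcH hcW

/-- Submodule form of the previous theorem: if moreover `(X₀, θ)` is of Weil type `(3,3)` (it is: isogenies preserve
`K`-types), its whole complexified Weil plane consists of algebraic classes, granted Schoen 1998 ALONE.
[cite: Schoen1998HodgeWeilAddendum, Theorem (p. 329) and §§10–13] [cite: vanGeemen1994HodgeAV, 4.9–4.10, Thm. 6.12] -/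
theorem weilClassesOf_le_algebraicClasses_of_isogeny_core_of_schoen1998
    (hS : Schoen1998_weilClasses_algebraic_hyperbolicSixfold_three) (hY : Y.dim = 4) (hE : E₀.dim = 1)
    (hψ : ψ ≫ ψ = -((3 : ℕ) • 𝟙 Y)) (hψ₀ : ψ₀ ≫ ψ₀ = -((3 : ℕ) • 𝟙 E₀))
    (hW : IsWeilType (Y.prod (E₀.prod E₀)) 𝚿[ψ, ψ₀] 3 3) (hW₀ : IsWeilType X₀ θ 3 3)
    (MB : HodgeModel (2 * 3) (Y.prod (E₀.prod E₀)).X)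
    (f : X₀ ⟶ Y.prod (E₀.prod E₀)) (g : Y.prod (E₀.prod E₀) ⟶ X₀) [AlgebraicGeometry.Flat f.hom.hom.hom.left]
    (hg : g ≫ θ = 𝚿[ψ, ψ₀] ≫ g) {m : ℕ} (hm : 0 < m) (hfg : f ≫ g = m • 𝟙 X₀) :
    weilClassesOf X₀ θ 3 3 ≤ algebraicClasses X₀.X 3 :=
  weilClassesOf_le_algebraicClasses_of_weilAlgebraicFor hW₀ fun _ hw hcQ hcH ↦
    weilClass_algebraic_of_isogeny_core_of_schoen1998 hS hY hE hψ hψ₀ hW hW₀.dim_eq MB f g hg hm hfg hcQ hcH hw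

/-- **`K = ℚ(i)`, `h = 6`: the same, granted Koike 2004 ALONE** (refereed; `d = 1`).
[cite: Koike2004WeilHodge, Thm. 2.1 and Cor. 2.1] [cite: vanGeemen1994HodgeAV, 3.6–3.7, 4.9, Lemma 5.2 (4), Thm. 6.12] -/
theorem weilClass_algebraic_of_isogeny_core_of_koike
    (hK : Koike2004_weilClasses_algebraic_hyperbolicSixfold_one) (hY : Y.dim = 4) (hE : E₀.dim = 1)
    (hψ : ψ ≫ ψ = -((1 : ℕ) • 𝟙 Y)) (hψ₀ : ψ₀ ≫ ψ₀ = -((1 : ℕ) • 𝟙 E₀))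
    (hW : IsWeilType (Y.prod (E₀.prod E₀)) 𝚿[ψ, ψ₀] 3 1)
    (hX₀ : X₀.dim = 2 * 3) (MB : HodgeModel (2 * 3) (Y.prod (E₀.prod E₀)).X)
    (f : X₀ ⟶ Y.prod (E₀.prod E₀)) (g : Y.prod (E₀.prod E₀) ⟶ X₀) [AlgebraicGeometry.Flat f.hom.hom.hom.left]
    (hg : g ≫ θ = 𝚿[ψ, ψ₀] ≫ g) {m : ℕ} (hm : 0 < m) (hfg : f ≫ g = m • 𝟙 X₀)
    {c : complexBetti X₀.X (2 * 3)} (hc : IsRationalClass c) (hcH : IsOfHodgeType (2 * 3) X₀.X (2 * 3) 3 3 c)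
    (hcW : c ∈ weilClassesOf X₀ θ 3 1) : c ∈ algebraicClasses X₀.X 3 :=
  weilClass_algebraic_of_isogeny_core_of_weilAlgebraicFor hW
    (weilAlgebraicFor_three_fourfold_prod_curve_sq_of_koike hK hY hE hψ hψ₀ hW) hX₀ MB f g hg hm hfg hc hcH hcW

/-- **Any `K = ℚ(√-d)`, `h = 6`: the same, granted Markman's F2** (UNREFEREED).
[cite: Markman2025SecantWeil, Thm. 1.5.1] [cite: vanGeemen1994HodgeAV, 3.6–3.7, 4.9, Lemma 5.2 (4), Thm. 6.12] -/
theorem weilClass_algebraic_of_isogeny_core_of_markman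
    (hM : Markman2025_weilClasses_algebraic_hyperbolicSixfold) (hY : Y.dim = 4) (hE : E₀.dim = 1)
    (hd : 0 < d) (hψ : ψ ≫ ψ = -(d • 𝟙 Y)) (hψ₀ : ψ₀ ≫ ψ₀ = -(d • 𝟙 E₀))
    (hW : IsWeilType (Y.prod (E₀.prod E₀)) 𝚿[ψ, ψ₀] 3 d)
    (hX₀ : X₀.dim = 2 * 3) (MB : HodgeModel (2 * 3) (Y.prod (E₀.prod E₀)).X)
    (f : X₀ ⟶ Y.prod (E₀.prod E₀)) (g : Y.prod (E₀.prod E₀) ⟶ X₀) [AlgebraicGeometry.Flat f.hom.hom.hom.left]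
    (hg : g ≫ θ = 𝚿[ψ, ψ₀] ≫ g) {m : ℕ} (hm : 0 < m) (hfg : f ≫ g = m • 𝟙 X₀)
    {c : complexBetti X₀.X (2 * 3)} (hc : IsRationalClass c) (hcH : IsOfHodgeType (2 * 3) X₀.X (2 * 3) 3 3 c)
    (hcW : c ∈ weilClassesOf X₀ θ 3 d) : c ∈ algebraicClasses X₀.X 3 :=
  weilClass_algebraic_of_isogeny_core_of_weilAlgebraicFor hW
    (weilAlgebraicFor_three_fourfold_prod_curve_sq_of_markmanSixfolds hM hY hE hd hψ hψ₀ hW)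
    hX₀ MB f g hg hm hfg hc hcH hcW

/-- On-path (the summit statement gives the conclusion of §2 outright). [cite: Deligne2000, §1] -/
theorem weilClass_algebraic_sixfold_onPath
    (h : ∀ ⦃n : ℕ⦄ ⦃X : Motives.SchemeOver ℂ⦄, Motives.IsSmoothProjective n X → HodgeConjectureFor n X)
    (hX₀ : X₀.dim = 2 * 3) {c : complexBetti X₀.X (2 * 3)} (hc : IsRationalClass c)
    (hcH : IsOfHodgeType (2 * 3) X₀.X (2 * 3) 3 3 c) : c ∈ algebraicClasses X₀.X 3 :=
  (h (Motives.isSmoothProjective_of_dim_eq' hX₀)).2 3 c hc hcH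

end Sixfold

/-! ## §3 `h = 8`: eightfolds `K`-isogenous to `S × core`, `S` a Weil-type `(1,d)` surface (the 96 classes of
`DEGCM-B` with `X₀ ~ S × E_ω² × B₄₈`, `S ∈ {E_ω(1,0) × E_ω(0,1), E_i²}`) -/

section Eightfold

variable {S X₀ : AbelianVariety ℂ} {σ : S ⟶ S} {θ : X₀ ⟶ X₀}

/-- **Eightfolds `K`-isogenous to `S × core`, granted `WeilAlgebraicFor 3 d` on the core** (fact-free): `(S, σ)` a
Weil-type `(1,d)` surface (its Weil classes are divisor classes: Lefschetz (1,1)), isogeny pair `f : X₀ ⟶ S × core`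
(flat), `g : S × core ⟶ X₀` with `g ≫ θ = (σ × (ψ × (ψ₀ × ψ₀))) ≫ g`, `f ≫ g = m`, `m ≥ 1`; then every rational `(4,4)`
class of the Weil plane of `(X₀, θ)` is algebraic (`⋀⁸_K(H¹(S) ⊕ H¹(core)) = ⋀²_K ⊗_K ⋀⁶_K`, van Geemen 5.2;
products of algebraic classes; isogeny transport). [cite: vanGeemen1994HodgeAV, 3.6–3.7, 4.9 and Lemma 5.2]
[cite: MoonenZarhin1999LowDim, Thm. 0.1] -/
theorem weilClass_algebraic_of_isogeny_surface_prod_core_of_weilAlgebraicFor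
    (hW : IsWeilType (Y.prod (E₀.prod E₀)) 𝚿[ψ, ψ₀] 3 d)
    (h : WeilAlgebraicFor 3 d (Y.prod (E₀.prod E₀)) 𝚿[ψ, ψ₀]) (hSW : IsWeilType S σ 1 d)
    (hX₀ : X₀.dim = 2 * (1 + 3)) (MB : HodgeModel (2 * (1 + 3)) (S.prod (Y.prod (E₀.prod E₀))).X)
    (f : X₀ ⟶ S.prod (Y.prod (E₀.prod E₀))) (g : S.prod (Y.prod (E₀.prod E₀)) ⟶ X₀)
    [AlgebraicGeometry.Flat f.hom.hom.hom.left]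
    (hg : g ≫ θ = AbelianVariety.prodLift (AbelianVariety.fst S (Y.prod (E₀.prod E₀)) ≫ σ)
      (AbelianVariety.snd S (Y.prod (E₀.prod E₀)) ≫ 𝚿[ψ, ψ₀]) ≫ g)
    {m : ℕ} (hm : 0 < m) (hfg : f ≫ g = m • 𝟙 X₀)
    {c : complexBetti X₀.X (2 * (1 + 3))} (hc : IsRationalClass c)
    (hcH : IsOfHodgeType (2 * (1 + 3)) X₀.X (2 * (1 + 3)) (1 + 3) (1 + 3) c)
    (hcW : c ∈ weilClassesOf X₀ θ (1 + 3) d) : c ∈ algebraicClasses X₀.X (1 + 3) :=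
  mem_algebraicClasses_of_isogeny_prod one_pos hW.d_pos hSW.dim_eq hW.dim_eq hSW.sq_eq hW.sq_eq
    (weilClassesOf_le_algebraicClasses_surface hSW.dim_eq hSW.d_pos hSW.sq_eq hSW.multiplicity_eq)
    (weilClassesOf_core_le_algebraicClasses_of_weilAlgebraicFor hW h) hX₀ MB f g hg hm hfg hc hcH hcW

/-- **`K = ℚ(√-3)`, `h = 8`: eightfolds `K`-isogenous to `S × (Y × E₀²)` have algebraic rational `(4,4)` Weil
classes, granted Schoen 1998 ALONE** (refereed) — the 96 classes of `DEGCM-B` with `X₀ ~ S × E_ω² × B₄₈`, `S` the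
`(1,1)` `K`-surface `E_ω(1,0) × E_ω(0,1)` (32 classes) or `E_i²` (64 classes).
[cite: Schoen1998HodgeWeilAddendum, Theorem (p. 329) and §§10–13] [cite: vanGeemen1994HodgeAV, 3.6–3.7, 4.9, Lemma 5.2 (4), Thm. 6.12]
[cite: MoonenZarhin1999LowDim, Thm. 0.1] -/
theorem weilClass_algebraic_of_isogeny_surface_prod_core_of_schoen1998
    (hS : Schoen1998_weilClasses_algebraic_hyperbolicSixfold_three) (hY : Y.dim = 4) (hE : E₀.dim = 1)
    (hψ : ψ ≫ ψ = -((3 : ℕ) • 𝟙 Y)) (hψ₀ : ψ₀ ≫ ψ₀ = -((3 : ℕ) • 𝟙 E₀))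
    (hW : IsWeilType (Y.prod (E₀.prod E₀)) 𝚿[ψ, ψ₀] 3 3) (hSW : IsWeilType S σ 1 3)
    (hX₀ : X₀.dim = 2 * (1 + 3)) (MB : HodgeModel (2 * (1 + 3)) (S.prod (Y.prod (E₀.prod E₀))).X)
    (f : X₀ ⟶ S.prod (Y.prod (E₀.prod E₀))) (g : S.prod (Y.prod (E₀.prod E₀)) ⟶ X₀)
    [AlgebraicGeometry.Flat f.hom.hom.hom.left]
    (hg : g ≫ θ = AbelianVariety.prodLift (AbelianVariety.fst S (Y.prod (E₀.prod E₀)) ≫ σ)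
      (AbelianVariety.snd S (Y.prod (E₀.prod E₀)) ≫ 𝚿[ψ, ψ₀]) ≫ g)
    {m : ℕ} (hm : 0 < m) (hfg : f ≫ g = m • 𝟙 X₀)
    {c : complexBetti X₀.X (2 * (1 + 3))} (hc : IsRationalClass c)
    (hcH : IsOfHodgeType (2 * (1 + 3)) X₀.X (2 * (1 + 3)) (1 + 3) (1 + 3) c)
    (hcW : c ∈ weilClassesOf X₀ θ (1 + 3) 3) : c ∈ algebraicClasses X₀.X (1 + 3) :=
  weilClass_algebraic_of_isogeny_surface_prod_core_of_weilAlgebraicFor hW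
    (weilAlgebraicFor_three_fourfold_prod_curve_sq_of_schoen hS hY hE hψ hψ₀ hW) hSW hX₀ MB f g hg hm hfg hc hcH hcW

/-- **`K = ℚ(i)`, `h = 8`: the same, granted Koike 2004 ALONE** (refereed; `d = 1`).
[cite: Koike2004WeilHodge, Thm. 2.1 and Cor. 2.1] [cite: vanGeemen1994HodgeAV, 3.6–3.7, 4.9, Lemma 5.2 (4), Thm. 6.12]
[cite: MoonenZarhin1999LowDim, Thm. 0.1] -/
theorem weilClass_algebraic_of_isogeny_surface_prod_core_of_koike
    (hK : Koike2004_weilClasses_algebraic_hyperbolicSixfold_one) (hY : Y.dim = 4) (hE : E₀.dim = 1)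
    (hψ : ψ ≫ ψ = -((1 : ℕ) • 𝟙 Y)) (hψ₀ : ψ₀ ≫ ψ₀ = -((1 : ℕ) • 𝟙 E₀))
    (hW : IsWeilType (Y.prod (E₀.prod E₀)) 𝚿[ψ, ψ₀] 3 1) (hSW : IsWeilType S σ 1 1)
    (hX₀ : X₀.dim = 2 * (1 + 3)) (MB : HodgeModel (2 * (1 + 3)) (S.prod (Y.prod (E₀.prod E₀))).X)
    (f : X₀ ⟶ S.prod (Y.prod (E₀.prod E₀))) (g : S.prod (Y.prod (E₀.prod E₀)) ⟶ X₀)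
    [AlgebraicGeometry.Flat f.hom.hom.hom.left]
    (hg : g ≫ θ = AbelianVariety.prodLift (AbelianVariety.fst S (Y.prod (E₀.prod E₀)) ≫ σ)
      (AbelianVariety.snd S (Y.prod (E₀.prod E₀)) ≫ 𝚿[ψ, ψ₀]) ≫ g)
    {m : ℕ} (hm : 0 < m) (hfg : f ≫ g = m • 𝟙 X₀)
    {c : complexBetti X₀.X (2 * (1 + 3))} (hc : IsRationalClass c)
    (hcH : IsOfHodgeType (2 * (1 + 3)) X₀.X (2 * (1 + 3)) (1 + 3) (1 + 3) c)
    (hcW : c ∈ weilClassesOf X₀ θ (1 + 3) 1) : c ∈ algebraicClasses X₀.X (1 + 3) :=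
  weilClass_algebraic_of_isogeny_surface_prod_core_of_weilAlgebraicFor hW
    (weilAlgebraicFor_three_fourfold_prod_curve_sq_of_koike hK hY hE hψ hψ₀ hW) hSW hX₀ MB f g hg hm hfg hc hcH hcW

/-- **Any `K = ℚ(√-d)`, `h = 8`: the same, granted Markman's F2** (UNREFEREED).
[cite: Markman2025SecantWeil, Thm. 1.5.1] [cite: vanGeemen1994HodgeAV, 3.6–3.7, 4.9, Lemma 5.2 (4), Thm. 6.12]
[cite: MoonenZarhin1999LowDim, Thm. 0.1] -/
theorem weilClass_algebraic_of_isogeny_surface_prod_core_of_markman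
    (hM : Markman2025_weilClasses_algebraic_hyperbolicSixfold) (hY : Y.dim = 4) (hE : E₀.dim = 1)
    (hd : 0 < d) (hψ : ψ ≫ ψ = -(d • 𝟙 Y)) (hψ₀ : ψ₀ ≫ ψ₀ = -(d • 𝟙 E₀))
    (hW : IsWeilType (Y.prod (E₀.prod E₀)) 𝚿[ψ, ψ₀] 3 d) (hSW : IsWeilType S σ 1 d)
    (hX₀ : X₀.dim = 2 * (1 + 3)) (MB : HodgeModel (2 * (1 + 3)) (S.prod (Y.prod (E₀.prod E₀))).X)
    (f : X₀ ⟶ S.prod (Y.prod (E₀.prod E₀))) (g : S.prod (Y.prod (E₀.prod E₀)) ⟶ X₀)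
    [AlgebraicGeometry.Flat f.hom.hom.hom.left]
    (hg : g ≫ θ = AbelianVariety.prodLift (AbelianVariety.fst S (Y.prod (E₀.prod E₀)) ≫ σ)
      (AbelianVariety.snd S (Y.prod (E₀.prod E₀)) ≫ 𝚿[ψ, ψ₀]) ≫ g)
    {m : ℕ} (hm : 0 < m) (hfg : f ≫ g = m • 𝟙 X₀)
    {c : complexBetti X₀.X (2 * (1 + 3))} (hc : IsRationalClass c)
    (hcH : IsOfHodgeType (2 * (1 + 3)) X₀.X (2 * (1 + 3)) (1 + 3) (1 + 3) c)
    (hcW : c ∈ weilClassesOf X₀ θ (1 + 3) d) : c ∈ algebraicClasses X₀.X (1 + 3) :=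
  weilClass_algebraic_of_isogeny_surface_prod_core_of_weilAlgebraicFor hW
    (weilAlgebraicFor_three_fourfold_prod_curve_sq_of_markmanSixfolds hM hY hE hd hψ hψ₀ hW)
    hSW hX₀ MB f g hg hm hfg hc hcH hcW

/-- On-path (the summit statement gives the conclusion of §3 outright). [cite: Deligne2000, §1] -/
theorem weilClass_algebraic_eightfold_onPath
    (h : ∀ ⦃n : ℕ⦄ ⦃X : Motives.SchemeOver ℂ⦄, Motives.IsSmoothProjective n X → HodgeConjectureFor n X)
    (hX₀ : X₀.dim = 2 * (1 + 3)) {c : complexBetti X₀.X (2 * (1 + 3))} (hc : IsRationalClass c)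
    (hcH : IsOfHodgeType (2 * (1 + 3)) X₀.X (2 * (1 + 3)) (1 + 3) (1 + 3) c) :
    c ∈ algebraicClasses X₀.X (1 + 3) :=
  (h (Motives.isSmoothProjective_of_dim_eq' hX₀)).2 (1 + 3) c hc hcH

end Eightfold

end Summit.HodgeConjecture.HodgeConjecture.Ring2.Motiv

end
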